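import Summits.CriticalPhenomena.PercolationContinuityZ3.Theorems.FK.Transplant.KNFreeSequentialTrials
import Summits.CriticalPhenomena.PercolationContinuityZ3.Theorems.FK.Transplant.KNFreeSlabDispatch
import Summits.CriticalPhenomena.PercolationContinuityZ3.Theorems.FK.Transplant.KNFreeSlabPlates
import Summits.CriticalPhenomena.PercolationContinuityZ3.Theorems.FK.Transplant.KNFreeTargetStepV
import HarnessLib

/-!
# FRONTIER TRANSPLANT, binder 2 (TP_FK) — T4-SLAB (S1): the slab Step IV's PROBABILISTIC CORE — pooling of the lanes under the
# shell-pinned law (sequential free trials across the relay's sub-plates) and ONE SUB-PLATE of the relay in the gated collar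

Support file (`--supports stmt-CriticalPhenomena-4575`, helper) of the FRONTIER TRANSPLANT sub-cell (`fk-continuity/transplant/`,
seat `prim-bschramm-fkt-p1`); builds on p205010 (kernel theorem, internal audit signed; external expert review pending).
0 definitions · 0 named facts · 0 sorries · standard axioms. File 14/18 of the bytes-first package (R60 (3)(β)) of the
UNFUNDED memo row `T4-SLAB [g122, R60]` (re-described R62 (E)); proposable only on a coordinator ruling.
Registered R63 (cell INBOX l.4709, 2026-08-23); registry row T4s; lead label T4s-14 (fkt-lead L22, l.4677).

HONEST FRAMING (page 1, cell rule). The transplant's theorem of record `ufsc0_of_freeBoundaryHypothesis_r3` (p248245) is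
CONDITIONAL on FH AND on TP_FK = `KNFreeTargetHittable d q p`, both OPEN at the same `p` for `q > 1` near `p_c(q)` (⇔ GRC Conj.
(5.103) via K1; barrier note `Literature.Barriers.CriticalPhenomena.SamePFreeBoundaryCriteria`, FBN-01, cited first); the
transplant is a typed reduction, not a proof of FK continuity. THIS FILE is the probabilistic core of the slab Step IV: `slab_pooling` — given sub-plates `P_k ⊆ S` behind the window
with the two-point bound `β` inside them and, for every exit `z`, a LANE region `(U ∩ slab_k) ∖ (S ∖ {z, w})` with
free-law connection bound `γ` to the far set, the free thin-shell law `fkLaw Λ (restrW S W) q` gives mass `≥ 1 - 3δ`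
to the patterns `ξ` under which some `u ∈ U(x)` reaches the target inside `D` with `φ_ξ`-probability `> 1 - δ`
(sequential free trials across sub-plates and first-moment pooling inside each, `KNFreeSequentialTrials`; the relay
inherits the lane's probability because the pinned pairs are frozen,
`fkLaw_pinW_real_le_of_inter_localCylinder_subset`) — Kozma–Nitzan's uniqueness zone (Lemma 7) replaced by shell
fan-out; `one_subplate` — ONE sub-plate: a placed slab copy inside the gated collar behind the face `U(x)`
(`KNFreeSlabPlates`, `KNFreeSlabGates.mem_gatedCollar_of_plate`), its exits on layer `T` or `1`, pairwise disjoint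
translates. It proves nothing about either binder and says nothing at `p ↓ p_c(q)`; NOT `_r4`; `_r3` « 2 / 0 ☑ », n_open = 2,
BINDER-OWNERS, FO-19 NO-GO unchanged.

Declarations: `mem_openConnIn_of_trans`, `slab_pooling`, `le_fkLaw_image_real_openConnIn_of_mem`, `one_subplate`.

References: G. Kozma, S. Nitzan, arXiv:2401.12397 (2024), §4 Lemma 7, Lemma 10 Step IV (pp. 19–21) [KozmaNitzan2024];
G. Grimmett, *The Random-Cluster Model*, Springer 2006, Thm. (3.7), Thm. (3.8), Thm. (3.21) eq. (3.22), Lemma (4.13), §5.7 [Grimmett2006].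
-/

noncomputable section

namespace Summit.CriticalPhenomena.PercolationContinuityZ3.Theorems.FK

open MeasureTheory
open scoped ENNReal Classical
open Literature.Probability.Percolation Literature.Probability.LatticeModels SimpleGraph
open Literature.Probability.Percolation.KozmaNitzan Transplant Literature.Barriers.CriticalPhenomena

variable {d : ℕ}

/-- Joining two connections through a common vertex inside a larger region. [folklore] -/
theorem mem_openConnIn_of_trans {A B C : Set (Site d)} {x y w : Site d} {ω : BondConfig (Site d)}
    (h1 : ω ∈ openConnIn A x y) (h2 : ω ∈ openConnIn B y w) (hA : A ⊆ C) (hB : B ⊆ C) : ω ∈ openConnIn C x w := by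
  obtain ⟨hx, _, hr⟩ := openConnIn_mono hA x y h1
  obtain ⟨_, hw, hr'⟩ := openConnIn_mono hB y w h2
  exact ⟨hx, hw, hr.trans hr'⟩

/-- **Pooling of the lanes (slab Step IV, probabilistic core).** `φ = fkLaw Λ · q`, `q ≥ 1`, `W` a subbox weighting at
`p` on `D ⊆ Λ`; `S ⊆ D` the frozen set; `U ⊆ D` the look box; sub-plates `P_0 … P_{n'-1} ⊆ S` pairwise disjoint with
relays `u_j ∈ Uface` and exits `z_{j,k}`, `k < n`, each joined to `u_j` inside `P_j` with free-law probability `≥ β`, the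
exits' `c`-coordinates more than `2L` apart; and for every exit a lane: `t ∈ Tgt`, `w` (`= z` or no neighbour of `z`),
`γ ≤ φ^free_R(z ↔ t in R)`, `R = (U ∩ slab) ∖ (S ∖ {z, w})`. If `(1 - β/2)^{n'} ≤ 3δ` and `(1-γ)^{⌈βn/2⌉} < δ` then
`1 - 3δ ≤ φ_{free S}{ξ | ∃ u ∈ Uface, φ_ξ(u ↔ Tgt in D) > 1 - δ}`, `φ_ξ` the law pinned to `ξ` on the pairs of `S`.
[cite: KozmaNitzan2024, §4 Lemma 10 Step IV (pp. 19–21); Grimmett2006, Thm. (3.7), Thm. (3.8), eq. (3.22), Thm. (5.104) proof] -/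
theorem slab_pooling {q : ℝ} (hq : 1 ≤ q) (p : unitInterval) (Λ : Finset (Site d)) (W : Sym2 (Site d) → unitInterval)
    (D : Finset (Site d)) (hsub : IsSubbox W p D) (hDΛ : D ⊆ Λ)
    (S : Finset (Site d)) (hSD : S ⊆ D) (U : Finset (Site d)) (hUD : U ⊆ D)
    (Tgt Uface : Finset (Site d)) (L : ℕ) (c : Fin d)
    {n' n : ℕ} (hn : 0 < n) (P : ℕ → Finset (Site d)) (u : ℕ → Site d) (z : ℕ → ℕ → Site d)
    (hPS : ∀ j < n', P j ⊆ S) (hPdisj : ∀ j₁ < n', ∀ j₂ < n', j₁ ≠ j₂ → Disjoint (P j₁) (P j₂))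
    (huU : ∀ j < n', u j ∈ Uface)
    {β γ δ : ℝ} (hβ : ∀ j < n', ∀ k < n, β ≤ (fkLaw (P j) (restrW (↑(P j) : Set (Site d)) (lattW d p)) q).real
      (openConnIn (↑(P j) : Set (Site d)) (u j) (z j k)))
    (hsep : ∀ j < n', ∀ k₁ < n, ∀ k₂ < n, k₁ ≠ k₂ → 2 * (L : ℤ) < |z j k₁ c - z j k₂ c|)
    (hlane : ∀ j < n', ∀ k < n, ∃ t w : Site d, t ∈ Tgt ∧ (z j k = w ∨ ¬ (zdGraph d).Adj (z j k) w) ∧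
      γ ≤ (fkLaw ((U.filter fun x => |x c - z j k c| ≤ (L : ℤ)) \ (S \ {z j k, w}))
        (restrW (↑((U.filter fun x => |x c - z j k c| ≤ (L : ℤ)) \ (S \ {z j k, w})) : Set (Site d)) (lattW d p)) q).real
        (openConnIn (↑((U.filter fun x => |x c - z j k c| ≤ (L : ℤ)) \ (S \ {z j k, w})) : Set (Site d)) (z j k) t))
    (hγ0 : 0 ≤ γ) (hγ1 : γ ≤ 1) (hδn' : (1 - β / 2) ^ n' ≤ 3 * δ) (hK : (1 - γ) ^ ⌈β * n / 2⌉₊ < δ) :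
    1 - 3 * δ ≤ (fkLaw Λ (restrW (↑S : Set (Site d)) W) q).real {ξ | ∃ u ∈ Uface,
      1 - δ < (fkLaw Λ (pinW W (wireSet (↑S : Set (Site d))) ξ) q).real (⋃ t ∈ Tgt, openConnIn (↑D : Set (Site d)) u t)} := by
  have hq0 : 0 < q := one_pos.trans_le hq
  haveI : IsProbabilityMeasure (fkLaw Λ (restrW (↑S : Set (Site d)) W) q) := isProbabilityMeasure_fkLaw _ _ hq0
  -- (i) the fan-out event under the free shell law
  have hWS : ∀ j < n', ∀ e ∈ wireSet (↑(P j) : Set (Site d)), lattW d p e ≤ restrW (↑S : Set (Site d)) W e := by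
    intro j hj e he
    have heS : e ∈ wireSet (↑S : Set (Site d)) := wireSet_mono (Finset.coe_subset.2 (hPS j hj)) he
    rw [restrW_apply_of_mem _ heS, hsub.eq_lattW (wireSet_mono (Finset.coe_subset.2 hSD) heS)]
  have hfan := one_sub_pow_le_fkLaw_real_exists_fanOut hq p Λ (restrW (↑S : Set (Site d)) W) hn
    (fun j hj => (hPS j hj).trans (hSD.trans hDΛ)) hPdisj hWS hβ
  have h3 : 1 - 3 * δ ≤ 1 - (1 - β / 2) ^ n' := by linarith
  refine h3.trans (hfan.trans (measureReal_mono (fun ξ hξ => ?_) (measure_ne_top _ _)))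
  -- (ii) a shell pattern in the fan-out event: the sub-plate `j`, the good exits `K`
  simp only [Set.mem_setOf_eq] at hξ
  obtain ⟨j, hj, hcard⟩ := hξ
  refine ⟨u j, huU j hj, ?_⟩
  set φξ := fkLaw Λ (pinW W (wireSet (↑S : Set (Site d))) ξ) q with hφξ
  haveI : IsProbabilityMeasure φξ := isProbabilityMeasure_fkLaw _ _ hq0
  set K := (Finset.range n).filter fun k => ξ ∈ openConnIn (↑(P j) : Set (Site d)) (u j) (z j k) with hKdef
  have hKn : ∀ k ∈ K, k < n := fun k hk => Finset.mem_range.1 (Finset.mem_filter.1 hk).1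
  have hKξ : ∀ k ∈ K, ξ ∈ openConnIn (↑(P j) : Set (Site d)) (u j) (z j k) := fun k hk => (Finset.mem_filter.1 hk).2
  -- the lanes of the exits
  obtain ⟨t, w, htw⟩ : ∃ (t w : ℕ → Site d), ∀ k < n, t k ∈ Tgt ∧ (z j k = w k ∨ ¬ (zdGraph d).Adj (z j k) (w k)) ∧
      γ ≤ (fkLaw ((U.filter fun x => |x c - z j k c| ≤ (L : ℤ)) \ (S \ {z j k, w k}))
        (restrW (↑((U.filter fun x => |x c - z j k c| ≤ (L : ℤ)) \ (S \ {z j k, w k})) : Set (Site d)) (lattW d p)) q).real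
        (openConnIn (↑((U.filter fun x => |x c - z j k c| ≤ (L : ℤ)) \ (S \ {z j k, w k})) : Set (Site d)) (z j k) (t k)) := by
    have := hlane j hj
    choose! t w ht using this
    exact ⟨t, w, ht⟩
  -- enumerate `K`
  set m := K.card with hm
  set kf : ℕ → ℕ := fun i => if h : i < m then ((K.equivFin.symm ⟨i, h⟩ : K) : ℕ) else 0 with hkf
  have hkfK : ∀ i < m, kf i ∈ K := by
    intro i hi; simp only [hkf, dif_pos hi]; exact (K.equivFin.symm ⟨i, hi⟩).2
  have hkfinj : ∀ i₁ < m, ∀ i₂ < m, i₁ ≠ i₂ → kf i₁ ≠ kf i₂ := by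
    intro i₁ h₁ i₂ h₂ hne heq
    apply hne
    have : (K.equivFin.symm ⟨i₁, h₁⟩) = (K.equivFin.symm ⟨i₂, h₂⟩) := by
      apply Subtype.ext; simp only [hkf, dif_pos h₁, dif_pos h₂] at heq; exact heq
    have := congrArg K.equivFin this
    simp only [Equiv.apply_symm_apply, Fin.mk.injEq] at this
    exact this
  -- regions and lane events
  set Rg : ℕ → Finset (Site d) := fun i =>
    (U.filter fun x => |x c - z j (kf i) c| ≤ (L : ℤ)) \ (S \ {z j (kf i), w (kf i)}) with hRg
  set A : ℕ → Set (BondConfig (Site d)) := fun i =>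
    openConnIn (↑(Rg i) : Set (Site d)) (z j (kf i)) (t (kf i)) with hA
  have hRgU : ∀ i, Rg i ⊆ U := fun i => Finset.sdiff_subset.trans (Finset.filter_subset _ _)
  have hpool := one_sub_pow_le_fkLaw_real_biUnion hq p Λ (pinW W (wireSet (↑S : Set (Site d))) ξ) (n := m) (S := Rg)
    (A := A) (α := γ)
    (fun i _ => (hRgU i).trans (hUD.trans hDΛ))
    (fun i₁ h₁ i₂ h₂ hne => by
      rw [Finset.disjoint_left]
      intro x hx₁ hx₂
      have h1 := (Finset.mem_filter.1 (Finset.mem_sdiff.1 hx₁).1).2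
      have h2 := (Finset.mem_filter.1 (Finset.mem_sdiff.1 hx₂).1).2
      have hs := hsep j hj (kf i₁) (hKn _ (hkfK i₁ h₁)) (kf i₂) (hKn _ (hkfK i₂ h₂)) (hkfinj i₁ h₁ i₂ h₂ hne)
      rw [abs_le] at h1 h2
      have : |z j (kf i₁) c - z j (kf i₂) c| ≤ 2 * (L : ℤ) := abs_le.2 ⟨by linarith, by linarith⟩
      linarith)
    (fun i _ => isUpperSet_openConnIn _ _ _) (fun i _ => measurableSet_openConnIn_of_countable _ _ _)
    (fun i _ => determinedBy_openConnIn_wireSet _ _ _ subset_rfl)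
    (fun i hi => lattW_le_pinW_of_frozen_pair hsub ((hRgU i).trans hUD)
      (fun x hx hxS => mem_pair_of_mem_sdiff_sdiff hx (Finset.mem_coe.1 hxS)) (htw (kf i) (hKn _ (hkfK i hi))).2.1 ξ)
    (fun i hi => (htw (kf i) (hKn _ (hkfK i hi))).2.2)
  -- `(1-γ)^m ≤ (1-γ)^{⌈βn/2⌉}` since `⌈βn/2⌉ ≤ #K = m`
  have hK₀m : ⌈β * n / 2⌉₊ ≤ m := Nat.ceil_le.2 (by rw [hm]; exact hcard)
  have hpow : (1 - γ) ^ m ≤ (1 - γ) ^ ⌈β * n / 2⌉₊ := pow_le_pow_of_le_one (by linarith) (by linarith) hK₀m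
  -- (iii) frozen transfer: a good lane plus the ξ-open path relay → exit gives `u_j ↔ t ∈ Tgt` inside `D`
  have hF : (↑(pairsF S) : Set (Sym2 (Site d))) ⊆ Set.range (Sym2.map (Subtype.val : ↥Λ → Site d)) := by
    rw [coe_pairsF]; exact (wireSet_mono (Finset.coe_subset.2 (hSD.trans hDΛ))).trans (wireSet_subset_range_sym2Map Λ)
  have htrans : φξ.real (⋃ i < m, A i) ≤ φξ.real (⋃ t ∈ Tgt, openConnIn (↑D : Set (Site d)) (u j) t) := by
    have hpin : pinW W (wireSet (↑S : Set (Site d))) ξ = pinW W (↑(pairsF S) : Set (Sym2 (Site d))) ξ := by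
      rw [coe_pairsF]
    rw [hφξ, hpin]
    refine fkLaw_pinW_real_le_of_inter_localCylinder_subset Λ hq W hF ξ fun ω hω => ?_
    obtain ⟨hωA, hωcyl⟩ := hω
    simp only [Set.mem_iUnion, exists_prop] at hωA ⊢
    obtain ⟨i, hi, hωi⟩ := hωA
    refine ⟨t (kf i), (htw (kf i) (hKn _ (hkfK i hi))).1, ?_⟩
    -- the relay-to-exit path of `ξ` inside `P j ⊆ S` is present in `ω` (agreement on the pairs of `S`)
    have hagree : ω ∩ wireSet (↑(P j) : Set (Site d)) = ξ ∩ wireSet (↑(P j) : Set (Site d)) := by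
      ext e
      simp only [Set.mem_inter_iff]
      constructor
      · rintro ⟨he, heP⟩
        have hePS : e ∈ (↑(pairsF S) : Set (Sym2 (Site d))) := by
          rw [coe_pairsF]; exact wireSet_mono (Finset.coe_subset.2 (hPS j hj)) heP
        exact ⟨(hωcyl e hePS).1 he, heP⟩
      · rintro ⟨he, heP⟩
        have hePS : e ∈ (↑(pairsF S) : Set (Sym2 (Site d))) := by
          rw [coe_pairsF]; exact wireSet_mono (Finset.coe_subset.2 (hPS j hj)) heP
        exact ⟨(hωcyl e hePS).2 he, heP⟩
    have hωP : ω ∈ openConnIn (↑(P j) : Set (Site d)) (u j) (z j (kf i)) :=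
      ((determinedBy_iff _ _).1 (determinedBy_openConnIn_wireSet (↑(P j) : Set (Site d)) (u j) (z j (kf i)) subset_rfl)
        ω ξ hagree).2 (hKξ _ (hkfK i hi))
    exact mem_openConnIn_of_trans hωP hωi (Finset.coe_subset.2 ((hPS j hj).trans hSD))
      (Finset.coe_subset.2 ((hRgU i).trans hUD))
  calc 1 - δ < 1 - (1 - γ) ^ ⌈β * n / 2⌉₊ := by linarith
    _ ≤ 1 - (1 - γ) ^ m := by linarith
    _ ≤ φξ.real (⋃ i < m, A i) := hpool
    _ ≤ _ := htrans

/-- **Two-point bound in a placed copy** from the uniform slab two-point hypothesis. [cite: Grimmett2006, §5.7 eq. (5.102)] -/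
theorem le_fkLaw_image_real_openConnIn_of_mem {q : ℝ} (p : unitInterval) {L N : ℕ} {β : ℝ}
    (hβ : ∀ (N : ℕ) (g : zdGraph d ≃g zdGraph d) (u z : Site d), u ∈ fkSlab d L N → z ∈ fkSlab d L N →
      β ≤ (fkLaw ((fkSlab d L N).image g) (restrW (↑((fkSlab d L N).image g) : Set (Site d)) (lattW d p)) q).real
        (openConnIn (↑((fkSlab d L N).image g) : Set (Site d)) (g u) (g z)))
    (π : Equiv.Perm (Fin d)) (ctr : Site d) {x y : Site d}
    (hx : x ∈ (fkSlab d L N).image (fun q => Site.signedPerm π 1 q + ctr))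
    (hy : y ∈ (fkSlab d L N).image (fun q => Site.signedPerm π 1 q + ctr)) :
    β ≤ (fkLaw ((fkSlab d L N).image (fun q => Site.signedPerm π 1 q + ctr))
      (restrW (↑((fkSlab d L N).image (fun q => Site.signedPerm π 1 q + ctr)) : Set (Site d)) (lattW d p)) q).real
      (openConnIn (↑((fkSlab d L N).image (fun q => Site.signedPerm π 1 q + ctr)) : Set (Site d)) x y) := by
  set giso : zdGraph d ≃g zdGraph d := (zdSignedPermIso π 1).trans (zdShiftIso ctr) with hgiso
  have hgimg : (fkSlab d L N).image giso = (fkSlab d L N).image (fun q => Site.signedPerm π 1 q + ctr) := rfl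
  obtain ⟨x₀, hx₀, hgx⟩ := Finset.mem_image.1 hx
  obtain ⟨y₀, hy₀, hgy⟩ := Finset.mem_image.1 hy
  have h1 := hβ N giso x₀ y₀ hx₀ hy₀
  rw [hgimg] at h1
  have hgx' : giso x₀ = x := hgx
  have hgy' : giso y₀ = y := hgy
  rw [hgx', hgy'] at h1
  exact h1

/-- **One sub-plate behind the window**: for a centre as in `exists_subplate_centres`, the placed copy lies in the gated
collar `S`, its relay `u = ctr[i ↦ y_i - σ]` lies in `U(x)` and in the copy, the exits `ctr[i ↦ zi][c ↦ ctr_c + s k Pl]`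
(`k < n`, `n·Pl ≤ N_P`) lie in the copy, their `c`-coordinates are `≥ Pl > 2L` apart, and they sit in the central window
on the side `s`. [cite: Grimmett2006, §5.7; KozmaNitzan2024, §4 pp. 19–21] -/
theorem one_subplate (hd : 3 ≤ d) {L : ℕ} (Lo Hi : Site d) (M : ℕ) (i : Fin d) (σ : ℤ) (y : Site d)
    (h : WinHyp Lo Hi M i σ y) (hwidei : Lo i + 4 * (M : ℤ) + 4 ≤ Hi i)
    (Pg Pbig N_P n Pl M₀ : ℕ) (g₀ : ℤ) (hP : Pbig = 2 * N_P + 3) (hnPl : n * Pl ≤ N_P) (hPl : 2 * L + 1 ≤ Pl)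
    (hLN_P : L ≤ N_P) (hPM₀ : Pbig ≤ M₀) (hM : M₀ + N_P + 2 * L + 1 ≤ M)
    (c e : Fin d) (hci : c ≠ i) (hei : e ≠ i) (hec : e ≠ c) (π : Equiv.Perm (Fin d))
    (hπc : π ⟨d - 2, by omega⟩ = c) (hπe : π ⟨d - 1, by omega⟩ = e) (s : ℤ) (hs : s = 1 ∨ s = -1)
    (zi : ℤ) (hzi : |zi - (y i - σ * ((L : ℤ) + 1))| ≤ (L : ℤ)) (ctr : Site d)
    (hctri : ctr i = y i - σ * ((L : ℤ) + 1))
    (hc1 : (N_P : ℤ) + 1 ≤ s * (ctr c - vctr Lo Hi M i σ y c) ∧ s * (ctr c - vctr Lo Hi M i σ y c) + N_P ≤ M₀)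
    (hresc : ctr c - N_P ≡ g₀ + 1 [ZMOD Pbig])
    (hoth : ∀ b, b ≠ i → b ≠ c → |ctr b - vctr Lo Hi M i σ y b| ≤ Pbig ∧ ctr b - N_P ≡ g₀ + 1 [ZMOD Pbig]) :
    (fkSlab d L N_P).image (fun q => Site.signedPerm π 1 q + ctr) ⊆
      ((Finset.Icc (Lo + 1) (Hi - 1) \ Finset.Icc (Lo + (((2 * L + 1 : ℕ) : Site d) + 1))
        (Hi - (((2 * L + 1 : ℕ) : Site d) + 1))).filter fun x => ¬ slabGate Lo Hi (2 * L + 1) Pg Pbig g₀ x) ∧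
    Function.update ctr i (y i - σ) ∈ uface Lo Hi M i σ y ∧
    Function.update ctr i (y i - σ) ∈ (fkSlab d L N_P).image (fun q => Site.signedPerm π 1 q + ctr) ∧
    (∀ k < n, Function.update (Function.update ctr i zi) c (ctr c + s * k * Pl) ∈
      (fkSlab d L N_P).image (fun q => Site.signedPerm π 1 q + ctr)) ∧
    (∀ k₁ < n, ∀ k₂ < n, k₁ ≠ k₂ → 2 * (L : ℤ) < |(ctr c + s * k₁ * Pl) - (ctr c + s * k₂ * Pl)|) ∧
    (∀ k < n, (∀ b, b ≠ i → |Function.update (Function.update ctr i zi) c (ctr c + s * k * Pl) b - vctr Lo Hi M i σ y b| ≤ M₀) ∧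
      |ctr c + s * k * Pl - vctr Lo Hi M i σ y c| ≤ (M₀ : ℤ)) := by
  have hd2 : 2 ≤ d := by omega
  set v := vctr Lo Hi M i σ y with hv
  have hface := h.face
  have hvb : ∀ b, b ≠ i → Lo b + M + 1 ≤ v b ∧ v b ≤ Hi b - M - 1 := fun b hb => by
    rw [hv, vctr_apply_of_ne hb]; exact wctr_mem_of_ne h hb
  have hN0 : (0 : ℤ) ≤ N_P := Nat.cast_nonneg N_P
  have hL0 : (0 : ℤ) ≤ L := Nat.cast_nonneg L
  have hnPl' : (n : ℤ) * Pl ≤ N_P := by exact_mod_cast hnPl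
  have hPM₀' : (Pbig : ℤ) ≤ M₀ := by exact_mod_cast hPM₀
  have hM' : (M₀ : ℤ) + N_P + 2 * L + 1 ≤ M := by exact_mod_cast hM
  have hctrb : ∀ b, b ≠ i → |ctr b - v b| ≤ M₀ := by
    intro b hb
    by_cases hbc : b = c
    · rw [hbc]; rcases hs with h1 | h1 <;> rw [h1] at hc1 <;> rw [abs_le] <;> constructor <;> linarith [hc1.1, hc1.2]
    · exact (hoth b hb hbc).1.trans hPM₀'
  have hkPl : ∀ k < n, (k : ℤ) * Pl ≤ N_P := by
    intro k hk
    have : ((k : ℤ) + 1) * Pl ≤ n * Pl := mul_le_mul_of_nonneg_right (by exact_mod_cast hk) (by positivity)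
    nlinarith
  refine ⟨fun x hx => ?_, ?_, ?_, fun k hk => ?_, fun k₁ _ k₂ _ hne => ?_, fun k hk => ?_⟩
  · -- the copy lies in the gated collar
    obtain ⟨hdepth, hdeep, hres⟩ := subplate_coords hd2 (T := 2 * L + 1) hP hLN_P Lo Hi i c e hci hei π hπc hπe σ (y i)
      hface v ctr M₀ M g₀ hctri hctrb (fun b hb => by
        by_cases hbc : b = c
        · rw [hbc]; exact hresc
        · exact (hoth b hb hbc).2) hvb (by omega) hx
    refine mem_gatedCollar_of_plate hd Lo Hi (2 * L + 1) Pg Pbig g₀ i (by push_cast; linarith) ?_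
      (fun b hb => ⟨(hdeep b hb).1, (hdeep b hb).2.1⟩) hres
    rcases h.sign with h1 | h1
    · left; have := hdepth.1 h1; push_cast; exact this
    · right; have := hdepth.2 h1; push_cast; exact this
  · refine update_mem_uface ctr fun b hb => ?_
    rw [← vctr_apply_of_ne (σ := σ) hb]
    exact (hctrb b hb).trans (by linarith)
  · exact (relay_exits_mem hd2 i c e hci hei π hπc hπe σ h.sign (y i) ctr hctri s hs Pl 0 (by simp)).1
  · rw [mem_image_signedPerm_add_iff_of_long hd2 π hπc hπe]
    refine ⟨?_, ?_, fun b hbc hbe => ?_⟩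
    · rw [Function.update_self, add_sub_cancel_left]
      rcases hs with h1 | h1 <;> rw [h1]
      · rw [one_mul, abs_of_nonneg (by positivity)]; exact hkPl k hk
      · rw [show (-1 : ℤ) * k * Pl = -(k * Pl) by ring, abs_neg, abs_of_nonneg (by positivity)]; exact hkPl k hk
    · rw [Function.update_of_ne hec, Function.update_of_ne hei, sub_self, abs_zero]; exact hN0
    · rw [Function.update_of_ne hbc]
      by_cases hbi : b = i
      · rw [hbi, Function.update_self, hctri]; exact hzi
      · rw [Function.update_of_ne hbi, sub_self, abs_zero]; exact hL0
  · have hdiff : ctr c + s * ↑k₁ * ↑Pl - (ctr c + s * ↑k₂ * ↑Pl) = s * (((k₁ : ℤ) - k₂) * Pl) := by ring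
    rw [hdiff, abs_mul, abs_mul, abs_of_nonneg (show (0 : ℤ) ≤ Pl by positivity)]
    have hsabs : |s| = 1 := by rcases hs with h1 | h1 <;> rw [h1] <;> norm_num
    rw [hsabs, one_mul]
    have hkk : (1 : ℤ) ≤ |(k₁ : ℤ) - k₂| := by
      rcases lt_or_gt_of_ne hne with hlt | hlt
      · have : (k₁ : ℤ) + 1 ≤ k₂ := by exact_mod_cast hlt
        rw [abs_of_neg (by linarith)]; linarith
      · have : (k₂ : ℤ) + 1 ≤ k₁ := by exact_mod_cast hlt
        rw [abs_of_nonneg (by linarith)]; linarith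
    have := mul_le_mul_of_nonneg_right hkk (show (0 : ℤ) ≤ Pl by positivity)
    have hPl' : 2 * (L : ℤ) + 1 ≤ Pl := by exact_mod_cast hPl
    linarith
  · have hkc : |ctr c + s * k * Pl - v c| ≤ (M₀ : ℤ) := by
      have hk' := hkPl k hk
      have hk0 : (0 : ℤ) ≤ (k : ℤ) * Pl := by positivity
      rcases hs with h1 | h1 <;> rw [h1] at hc1 ⊢ <;> rw [abs_le] <;> constructor <;> nlinarith [hc1.1, hc1.2]
    refine ⟨fun b hb => ?_, hkc⟩
    by_cases hbc : b = c
    · rw [hbc, Function.update_self]; exact hkc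
    · rw [Function.update_of_ne hbc, Function.update_of_ne hb]; exact hctrb b hb

end Summit.CriticalPhenomena.PercolationContinuityZ3.Theorems.FK

end
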